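/-
Copyright (c) 2026 The HCML crux team. All rights reserved.
Released under Apache 2.0 license as described in the file LICENSE.
Authors: K2E5-p17 (g5) (explicit-unit `hodgecm-mathlib-K2E5-p17-g5`) — the `N = 2` twin, statement for statement, of ★ (B0a) `K2E3GL3ModCocompactCentral` by K2E3-p23 (g4)
-/
import Summits.HodgeConjecture.HodgeConjecture.Theorems.K2E3GL2ModCentreUnimodular      -- ★ (2F-a′) (this seat): brings ★ (2F-a) `K2E3GL2ModCentre` (`isClosed_center_gl2`, `t2Space_quot`, frame) and the Haar API
import Summits.HodgeConjecture.HodgeConjecture.Theorems.K2E3UnipotentConjTwistBochner    -- ★ `exists_isCompact_subset_mul_of_isCompact_image_mk` (compact sets of `G ⧸ T` lift)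
import HarnessLib

/-!
# (road «GL₂-sc», brick 2F-b = B0a at N = 2) The groups `G_Λ = GL₂(F) ⧸ Λ·1` for a closed cocompact `Λ ≤ F^×`, and the projection `q_Λ : G_Λ → Ḡ = GL₂(F) ⧸ Z`

Cell `hodgecm-mathlib`, Track B, line `K2_E3_EllipticInputs`; letter (S-C′-GL₂sc) of leaf (nsc-S-C′) (leaf owner K2E3-p24 (g0), dealer K2E3-plan DEAL 2026-09-04 08:25Z, census
`K2/K2E5-p17/g5/CENSUS-GL2sc.K2E5-p17-g5.md` §2); seat K2E5-p17 (g5).  The `N = 2` TWIN, statement for statement, of ★ (B0a) `K2E3GL3ModCocompactCentral` (K2E3-p23 (g4) p857674).  A supercuspidal class of `GL₂(F)` is trivial on a closed COCOMPACT subgroup `Λ·1` of the centre `Z = F^×·1` (after an unramified twist); the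
compact-centre character pipeline then runs on `G_Λ := GL₂(F) ⧸ Λ·1`.  This file is the topological frame of `G_Λ` and of the projection `q_Λ : G_Λ → Ḡ`:

* §1 `N_Λ := Λ.map scalar ≤ Z` (`map_scalar_le_center`), normal (`normal_map_scalar`), `continuous_scalar`.
* §2 `N_Λ` is closed for `Λ` closed (`isClosed_map_scalar`: `N_Λ = Z ∩ ψ⁻¹(embedProduct '' Λ)` with `ψ(g) = (g₀₀, op g⁻¹₀₀)`), so `G_Λ` is `T2` (`t2Space_quotScalar`).
* §3 the image of `Z` in `G_Λ` is compact when `F^× ⧸ Λ` is (`isCompact_image_center`: it is the range of the continuous lift `F^× ⧸ Λ → G_Λ`).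
* §4 `q_Λ = QuotientGroup.map N_Λ Z id`: continuous, open, surjective, compact preimages of compacta (`isCompact_preimage_quotMap`), `Tendsto q_Λ cocompact cocompact`,
  and `μ_Λ.map q_Λ` is a Haar measure on `Ḡ` (`isHaarMeasure_map_quotMap`).

HONEST LABEL: HC_CM is proved only modulo the 7 printed citations (2 remaining named inputs: hLiu418 = stmt-HodgeConjecture-24832, h413 =
stmt-HodgeConjecture-24833) until rung 0 closes; count-neutral (kernel lane `--supports stmt-HodgeConjecture-24833 --as helper`), THEOREMS ONLY.

References: Harish-Chandra (van Dijk) 1970, Part VII §3 (the passage `G → °G`, `G ⧸ Z`) [cite: HarishChandra1970, Part VII §3 p. 70]; Bourbaki, *Intégration* VII §2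
(Haar measures and quotients by compact normal subgroups) [cite: WeilIntegration1965, §7]; Platonov–Rapinchuk 1994 §3.3 [cite: PlatonovRapinchuk1994, §3.3].
-/

open MeasureTheory MeasureTheory.Measure Set Function Filter
open scoped MatrixGroups Pointwise Topology
open Matrix
open Literature.NumberTheory.Automorphic Literature.NumberTheory.GaloisRepresentations Literature.NumberTheory.GaloisRepresentations.IsNonarchimedeanLocalField
open Summit.HodgeConjecture.HodgeConjecture.Cruxes.H413.K2E3GL2ModCentre

set_option linter.dupNamespace false

namespace Summit.HodgeConjecture.HodgeConjecture.Cruxes.H413.K2E3GL2ModCocompactCentral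

/-! ## §1 `N_Λ = Λ·1 ≤ Z`, normal; continuity of `scalar` -/

section Algebra

variable {F : Type*} [Field F]

/-- `Λ·1 ≤ Z(GL₂(F))`. [cite: PlatonovRapinchuk1994, §3.3] -/
theorem map_scalar_le_center (Λ₀ : Subgroup Fˣ) :
    Λ₀.map (Matrix.GeneralLinearGroup.scalar (Fin 2)) ≤ Subgroup.center (GL (Fin 2) F) := by
  rintro _ ⟨c, -, rfl⟩
  rw [Matrix.GeneralLinearGroup.center_eq_range_scalar]
  exact ⟨c, rfl⟩

/-- `Λ·1` is a normal subgroup of `GL₂(F)` (it is central). [cite: PlatonovRapinchuk1994, §3.3] -/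
theorem normal_map_scalar (Λ₀ : Subgroup Fˣ) : (Λ₀.map (Matrix.GeneralLinearGroup.scalar (Fin 2))).Normal :=
  ⟨fun n hn g => by
    have hc := Subgroup.mem_center_iff.1 (map_scalar_le_center Λ₀ hn) g
    rw [hc, mul_inv_cancel_right]
    exact hn⟩

/-- `Λ·1 ≤ Z.comap id` (the hypothesis of `QuotientGroup.map`). [folklore] -/
theorem map_scalar_le_comap_center (Λ₀ : Subgroup Fˣ) :
    Λ₀.map (Matrix.GeneralLinearGroup.scalar (Fin 2)) ≤ (Subgroup.center (GL (Fin 2) F)).comap (MonoidHom.id (GL (Fin 2) F)) := fun x hx => by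
  rw [Subgroup.mem_comap, MonoidHom.id_apply]
  exact map_scalar_le_center Λ₀ hx

/-- Entry `(0,0)` of `c·1` is `c`. [folklore] -/
theorem scalar_apply_zero_zero (c : Fˣ) : ((Matrix.GeneralLinearGroup.scalar (Fin 2) c : GL (Fin 2) F) : Matrix (Fin 2) (Fin 2) F) 0 0 = (c : F) := by
  rw [Matrix.GeneralLinearGroup.coe_scalar, Matrix.scalar_apply, Matrix.diagonal_apply_eq]

variable [TopologicalSpace F] [IsTopologicalRing F]

omit [IsTopologicalRing F] in
/-- `c ↦ c·1 : F^× → GL₂(F)` is continuous. [folklore] -/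
theorem continuous_scalar : Continuous (Matrix.GeneralLinearGroup.scalar (Fin 2) : Fˣ → GL (Fin 2) F) := by
  refine Units.continuous_iff.mpr ⟨?_, ?_⟩
  · show Continuous fun c : Fˣ => ((Matrix.GeneralLinearGroup.scalar (Fin 2) c : GL (Fin 2) F) : Matrix (Fin 2) (Fin 2) F)
    have h : (fun c : Fˣ => ((Matrix.GeneralLinearGroup.scalar (Fin 2) c : GL (Fin 2) F) : Matrix (Fin 2) (Fin 2) F)) = fun c : Fˣ => Matrix.diagonal fun _ : Fin 2 => (c : F) := by
      funext c; rw [Matrix.GeneralLinearGroup.coe_scalar, Matrix.scalar_apply]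
    rw [h]
    exact (continuous_pi fun _ => Units.continuous_val).matrix_diagonal
  · show Continuous fun c : Fˣ => (((Matrix.GeneralLinearGroup.scalar (Fin 2) c)⁻¹ : GL (Fin 2) F) : Matrix (Fin 2) (Fin 2) F)
    have h : (fun c : Fˣ => (((Matrix.GeneralLinearGroup.scalar (Fin 2) c)⁻¹ : GL (Fin 2) F) : Matrix (Fin 2) (Fin 2) F)) = fun c : Fˣ => Matrix.diagonal fun _ : Fin 2 => ((c⁻¹ : Fˣ) : F) := by
      funext c; rw [← map_inv, Matrix.GeneralLinearGroup.coe_scalar, Matrix.scalar_apply]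
    rw [h]
    exact (continuous_pi fun _ => Units.continuous_coe_inv).matrix_diagonal

end Algebra

/-! ## §2 `N_Λ` closed, `G_Λ` Hausdorff -/

section Closed

variable {F : Type*} [Field F] [ValuativeRel F] [TopologicalSpace F] [IsNonarchimedeanLocalField F]

/-- **`Λ·1` is closed in `GL₂(F)` for `Λ ≤ F^×` closed**: `Λ·1 = Z ∩ ψ⁻¹(embedProduct(Λ))`, `ψ(g) = (g₀₀, op (g⁻¹)₀₀)`, with `Z` closed ★ and `embedProduct` a closed embedding.
[cite: PlatonovRapinchuk1994, §3.3] -/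
theorem isClosed_map_scalar (Λ₀ : Subgroup Fˣ) (hΛ : IsClosed (Λ₀ : Set Fˣ)) :
    IsClosed ((Λ₀.map (Matrix.GeneralLinearGroup.scalar (Fin 2)) : Subgroup (GL (Fin 2) F)) : Set (GL (Fin 2) F)) := by
  haveI : IsTopologicalRing F := inferInstance
  haveI : T2Space F := (isLocalField F).toT2Space
  have hψ : Continuous fun g : GL (Fin 2) F => (((g : Matrix (Fin 2) (Fin 2) F) 0 0, MulOpposite.op ((((g⁻¹ : GL (Fin 2) F)) : Matrix (Fin 2) (Fin 2) F) 0 0)) : F × Fᵐᵒᵖ) :=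
    (Units.continuous_val.matrix_elem 0 0).prodMk (MulOpposite.continuous_op.comp (Units.continuous_coe_inv.matrix_elem 0 0))
  have hC : IsClosed ((Units.embedProduct F) '' (Λ₀ : Set Fˣ)) := Units.isClosedEmbedding_embedProduct.isClosedMap _ hΛ
  have heq : ((Λ₀.map (Matrix.GeneralLinearGroup.scalar (Fin 2)) : Subgroup (GL (Fin 2) F)) : Set (GL (Fin 2) F)) =
      (Subgroup.center (GL (Fin 2) F) : Set (GL (Fin 2) F)) ∩
        (fun g : GL (Fin 2) F => (((g : Matrix (Fin 2) (Fin 2) F) 0 0, MulOpposite.op ((((g⁻¹ : GL (Fin 2) F)) : Matrix (Fin 2) (Fin 2) F) 0 0)) : F × Fᵐᵒᵖ)) ⁻¹'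
          ((Units.embedProduct F) '' (Λ₀ : Set Fˣ)) := by
    ext g
    constructor
    · rintro ⟨c, hc, rfl⟩
      refine ⟨map_scalar_le_center Λ₀ (Subgroup.mem_map_of_mem _ hc), c, hc, ?_⟩
      show Units.embedProduct F c = (((Matrix.GeneralLinearGroup.scalar (Fin 2) c : GL (Fin 2) F) : Matrix (Fin 2) (Fin 2) F) 0 0,
        MulOpposite.op ((((Matrix.GeneralLinearGroup.scalar (Fin 2) c)⁻¹ : GL (Fin 2) F) : Matrix (Fin 2) (Fin 2) F) 0 0))
      rw [Units.embedProduct_apply, ← map_inv, scalar_apply_zero_zero, scalar_apply_zero_zero]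
    · rintro ⟨hz, c, hc, hψc⟩
      rw [SetLike.mem_coe, Matrix.GeneralLinearGroup.center_eq_range_scalar] at hz
      obtain ⟨c', rfl⟩ := hz
      have h1 : (c : F) = c' := by
        have := congrArg Prod.fst hψc
        dsimp only at this
        rwa [Units.embedProduct_apply, scalar_apply_zero_zero] at this
      exact ⟨c', (Units.ext h1) ▸ hc, rfl⟩
  rw [heq]
  exact (isClosed_center_gl2 F).inter (hC.preimage hψ)

/-- `G_Λ = GL₂(F) ⧸ Λ·1` is Hausdorff (indeed `T3`) for `Λ` closed. [cite: PlatonovRapinchuk1994, §3.3] -/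
theorem t2Space_quotScalar (Λ₀ : Subgroup Fˣ) (hΛ : IsClosed (Λ₀ : Set Fˣ)) [(Λ₀.map (Matrix.GeneralLinearGroup.scalar (Fin 2))).Normal] :
    T2Space (GL (Fin 2) F ⧸ Λ₀.map (Matrix.GeneralLinearGroup.scalar (Fin 2))) := by
  haveI : IsClosed ((Λ₀.map (Matrix.GeneralLinearGroup.scalar (Fin 2)) : Subgroup (GL (Fin 2) F)) : Set (GL (Fin 2) F)) := isClosed_map_scalar Λ₀ hΛ
  infer_instance

end Closed

/-! ## §3 The image of the centre in `G_Λ` is compact -/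

section CompactCentreImage

variable {F : Type*} [Field F] [TopologicalSpace F] [IsTopologicalRing F]

omit [TopologicalSpace F] [IsTopologicalRing F] in
/-- `Λ ≤ ker (mk ∘ scalar)`. [folklore] -/
theorem le_ker_mk_comp_scalar (Λ₀ : Subgroup Fˣ) [(Λ₀.map (Matrix.GeneralLinearGroup.scalar (Fin 2))).Normal] :
    Λ₀ ≤ ((QuotientGroup.mk' (Λ₀.map (Matrix.GeneralLinearGroup.scalar (Fin 2)))).comp (Matrix.GeneralLinearGroup.scalar (Fin 2) : Fˣ →* GL (Fin 2) F)).ker :=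
  fun c hc => by
    rw [MonoidHom.mem_ker, MonoidHom.comp_apply, QuotientGroup.mk'_apply, QuotientGroup.eq_one_iff]
    exact Subgroup.mem_map_of_mem _ hc

omit [IsTopologicalRing F] in
/-- **The image of `Z` in `G_Λ` is compact when `F^× ⧸ Λ` is**: it is the range of the continuous lift `F^× ⧸ Λ → G_Λ` of `mk ∘ scalar`.
[cite: HarishChandra1970, Part VII §3 p. 70] -/
theorem isCompact_image_center (Λ₀ : Subgroup Fˣ) [(Λ₀.map (Matrix.GeneralLinearGroup.scalar (Fin 2))).Normal] [CompactSpace (Fˣ ⧸ Λ₀)] :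
    IsCompact ((QuotientGroup.mk : GL (Fin 2) F → GL (Fin 2) F ⧸ Λ₀.map (Matrix.GeneralLinearGroup.scalar (Fin 2))) ''
      (Subgroup.center (GL (Fin 2) F) : Set (GL (Fin 2) F))) := by
  set φ : Fˣ →* GL (Fin 2) F ⧸ Λ₀.map (Matrix.GeneralLinearGroup.scalar (Fin 2)) :=
    (QuotientGroup.mk' (Λ₀.map (Matrix.GeneralLinearGroup.scalar (Fin 2)))).comp (Matrix.GeneralLinearGroup.scalar (Fin 2)) with hφ
  have hφc : Continuous φ := QuotientGroup.continuous_mk.comp continuous_scalar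
  set ℓ := QuotientGroup.lift Λ₀ φ (le_ker_mk_comp_scalar Λ₀) with hℓ
  have hℓc : Continuous ℓ := by
    refine (QuotientGroup.isQuotientMap_mk Λ₀).continuous_iff.2 ?_
    have : (ℓ : Fˣ ⧸ Λ₀ → _) ∘ (QuotientGroup.mk : Fˣ → Fˣ ⧸ Λ₀) = φ := funext fun c => QuotientGroup.lift_mk Λ₀ (le_ker_mk_comp_scalar Λ₀) c
    rw [this]; exact hφc
  have heq : (QuotientGroup.mk : GL (Fin 2) F → GL (Fin 2) F ⧸ Λ₀.map (Matrix.GeneralLinearGroup.scalar (Fin 2))) '' (Subgroup.center (GL (Fin 2) F) : Set (GL (Fin 2) F)) =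
      Set.range ℓ := by
    ext y
    constructor
    · rintro ⟨g, hg, rfl⟩
      rw [SetLike.mem_coe, Matrix.GeneralLinearGroup.center_eq_range_scalar] at hg
      obtain ⟨c, rfl⟩ := hg
      exact ⟨(c : Fˣ ⧸ Λ₀), by rw [hℓ, QuotientGroup.lift_mk]; rfl⟩
    · rintro ⟨x, rfl⟩
      obtain ⟨c, rfl⟩ := QuotientGroup.mk_surjective x
      refine ⟨Matrix.GeneralLinearGroup.scalar (Fin 2) c, ?_, by rw [hℓ, QuotientGroup.lift_mk]; rfl⟩
      rw [SetLike.mem_coe, Matrix.GeneralLinearGroup.center_eq_range_scalar]; exact ⟨c, rfl⟩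
  rw [heq]
  exact isCompact_range hℓc

end CompactCentreImage

/-! ## §4 The projection `q_Λ : G_Λ → Ḡ` -/

section Projection

variable {F : Type*} [Field F] [ValuativeRel F] [TopologicalSpace F] [IsNonarchimedeanLocalField F]
  (Λ₀ : Subgroup Fˣ) [(Λ₀.map (Matrix.GeneralLinearGroup.scalar (Fin 2))).Normal]
  (hle : Λ₀.map (Matrix.GeneralLinearGroup.scalar (Fin 2)) ≤ (Subgroup.center (GL (Fin 2) F)).comap (MonoidHom.id (GL (Fin 2) F)))

omit [ValuativeRel F] [TopologicalSpace F] [IsNonarchimedeanLocalField F] in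
/-- `q_Λ ∘ mk_Λ = mk_Z`. [folklore] -/
theorem quotMap_mk (g : GL (Fin 2) F) :
    QuotientGroup.map _ (Subgroup.center (GL (Fin 2) F)) (MonoidHom.id (GL (Fin 2) F)) hle (QuotientGroup.mk g) = (QuotientGroup.mk g : GL (Fin 2) F ⧸ Subgroup.center (GL (Fin 2) F)) :=
  QuotientGroup.map_mk _ _ _ hle g

omit [ValuativeRel F] [IsNonarchimedeanLocalField F] in
/-- `q_Λ` is continuous. [cite: WeilIntegration1965, §7] -/
theorem continuous_quotMap : Continuous (QuotientGroup.map _ (Subgroup.center (GL (Fin 2) F)) (MonoidHom.id (GL (Fin 2) F)) hle) := by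
  refine (QuotientGroup.isQuotientMap_mk _).continuous_iff.2 ?_
  have : (QuotientGroup.map _ (Subgroup.center (GL (Fin 2) F)) (MonoidHom.id (GL (Fin 2) F)) hle : _ → _) ∘ (QuotientGroup.mk : GL (Fin 2) F → _) =
      (QuotientGroup.mk : GL (Fin 2) F → GL (Fin 2) F ⧸ Subgroup.center (GL (Fin 2) F)) := funext fun g => quotMap_mk Λ₀ hle g
  rw [this]
  exact QuotientGroup.continuous_mk

omit [ValuativeRel F] [TopologicalSpace F] [IsNonarchimedeanLocalField F] in
/-- `q_Λ` is surjective. [folklore] -/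
theorem surjective_quotMap : Function.Surjective (QuotientGroup.map _ (Subgroup.center (GL (Fin 2) F)) (MonoidHom.id (GL (Fin 2) F)) hle) := by
  intro y
  obtain ⟨g, rfl⟩ := QuotientGroup.mk_surjective y
  exact ⟨QuotientGroup.mk g, quotMap_mk Λ₀ hle g⟩

/-- `q_Λ` is an open map. [cite: WeilIntegration1965, §7] -/
theorem isOpenMap_quotMap : IsOpenMap (QuotientGroup.map _ (Subgroup.center (GL (Fin 2) F)) (MonoidHom.id (GL (Fin 2) F)) hle) := by
  intro U hU
  have heq : (QuotientGroup.map _ (Subgroup.center (GL (Fin 2) F)) (MonoidHom.id (GL (Fin 2) F)) hle) '' U =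
      (QuotientGroup.mk : GL (Fin 2) F → GL (Fin 2) F ⧸ Subgroup.center (GL (Fin 2) F)) '' ((QuotientGroup.mk : GL (Fin 2) F → _) ⁻¹' U) := by
    ext y
    constructor
    · rintro ⟨x, hx, rfl⟩
      obtain ⟨g, rfl⟩ := QuotientGroup.mk_surjective x
      exact ⟨g, hx, (quotMap_mk Λ₀ hle g).symm⟩
    · rintro ⟨g, hg, rfl⟩
      exact ⟨QuotientGroup.mk g, hg, quotMap_mk Λ₀ hle g⟩
  rw [heq]
  exact QuotientGroup.isOpenMap_coe _ (hU.preimage QuotientGroup.continuous_mk)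

/-- **Preimages of compacta under `q_Λ` are compact** (`F^× ⧸ Λ` compact): `q_Λ⁻¹(K̄) ⊆ mk_Λ(C) · mk_Λ(Z)` with `C` a compact lift of `K̄` ★ and `mk_Λ(Z)` compact (§3).
[cite: WeilIntegration1965, §7] -/
theorem isCompact_preimage_quotMap [CompactSpace (Fˣ ⧸ Λ₀)] {K : Set (GL (Fin 2) F ⧸ Subgroup.center (GL (Fin 2) F))}
    (hK : IsCompact K) :
    IsCompact ((QuotientGroup.map _ (Subgroup.center (GL (Fin 2) F)) (MonoidHom.id (GL (Fin 2) F)) hle) ⁻¹' K) := by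
  haveI : LocallyCompactSpace (GL (Fin 2) F) := locallyCompactSpace_gl2 F
  haveI : T2Space (GL (Fin 2) F ⧸ Subgroup.center (GL (Fin 2) F)) := t2Space_quot F
  -- a compact lift `C ⊆ GL₂(F)` of `K`
  set S : Set (GL (Fin 2) F) := (QuotientGroup.mk : GL (Fin 2) F → GL (Fin 2) F ⧸ Subgroup.center (GL (Fin 2) F)) ⁻¹' K with hS
  have hSK : (QuotientGroup.mk : GL (Fin 2) F → GL (Fin 2) F ⧸ Subgroup.center (GL (Fin 2) F)) '' S = K :=
    Set.image_preimage_eq K QuotientGroup.mk_surjective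
  obtain ⟨C, hC, hSC⟩ := K2E3UnipotentConjTwistBochner.exists_isCompact_subset_mul_of_isCompact_image_mk (Subgroup.center (GL (Fin 2) F)) (S := S) (by rw [hSK]; exact hK)
  have hbig : IsCompact ((QuotientGroup.mk : GL (Fin 2) F → GL (Fin 2) F ⧸ Λ₀.map (Matrix.GeneralLinearGroup.scalar (Fin 2))) '' C *
      (QuotientGroup.mk : GL (Fin 2) F → GL (Fin 2) F ⧸ Λ₀.map (Matrix.GeneralLinearGroup.scalar (Fin 2))) '' (Subgroup.center (GL (Fin 2) F) : Set (GL (Fin 2) F))) :=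
    (hC.image QuotientGroup.continuous_mk).mul (isCompact_image_center Λ₀)
  refine hbig.of_isClosed_subset (hK.isClosed.preimage (continuous_quotMap Λ₀ hle)) ?_
  intro y hy
  obtain ⟨g, rfl⟩ := QuotientGroup.mk_surjective y
  have hg : g ∈ S := hy
  obtain ⟨c, hc, z, hz, rfl⟩ := hSC hg
  rw [QuotientGroup.mk_mul]
  exact Set.mul_mem_mul ⟨c, hc, rfl⟩ ⟨z, hz, rfl⟩

/-- **`q_Λ` is proper**: `Tendsto q_Λ cocompact cocompact`. [cite: WeilIntegration1965, §7] -/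
theorem tendsto_cocompact_quotMap [CompactSpace (Fˣ ⧸ Λ₀)] :
    Tendsto (QuotientGroup.map _ (Subgroup.center (GL (Fin 2) F)) (MonoidHom.id (GL (Fin 2) F)) hle)
      (cocompact (GL (Fin 2) F ⧸ Λ₀.map (Matrix.GeneralLinearGroup.scalar (Fin 2)))) (cocompact (GL (Fin 2) F ⧸ Subgroup.center (GL (Fin 2) F))) := by
  rw [hasBasis_cocompact.tendsto_right_iff]
  intro K hK
  filter_upwards [(isCompact_preimage_quotMap Λ₀ hle hK).compl_mem_cocompact] with x hx
  exact hx

/-- **The pushforward of a Haar measure of `G_Λ` under `q_Λ` is a Haar measure of `Ḡ`** (continuous proper surjective hom — Mathlib `isHaarMeasure_map`).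
[cite: WeilIntegration1965, §7] -/
theorem isHaarMeasure_map_quotMap [CompactSpace (Fˣ ⧸ Λ₀)]
    [MeasurableSpace (GL (Fin 2) F ⧸ Λ₀.map (Matrix.GeneralLinearGroup.scalar (Fin 2)))] [BorelSpace (GL (Fin 2) F ⧸ Λ₀.map (Matrix.GeneralLinearGroup.scalar (Fin 2)))]
    [MeasurableSpace (GL (Fin 2) F ⧸ Subgroup.center (GL (Fin 2) F))] [BorelSpace (GL (Fin 2) F ⧸ Subgroup.center (GL (Fin 2) F))]
    (μ : Measure (GL (Fin 2) F ⧸ Λ₀.map (Matrix.GeneralLinearGroup.scalar (Fin 2)))) [μ.IsHaarMeasure] :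
    (μ.map (QuotientGroup.map _ (Subgroup.center (GL (Fin 2) F)) (MonoidHom.id (GL (Fin 2) F)) hle)).IsHaarMeasure :=
  isHaarMeasure_map μ _ (continuous_quotMap Λ₀ hle) (surjective_quotMap Λ₀ hle) (tendsto_cocompact_quotMap Λ₀ hle)

end Projection

end Summit.HodgeConjecture.HodgeConjecture.Cruxes.H413.K2E3GL2ModCocompactCentral
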